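import Summits.ValiantsHypothesis.ValiantsHypothesis.Theses.ElementaryWordLength

/-!
# Sketch — crux `WordPerCubic` (stmt-ValiantsHypothesis-6625), crux-ideate round 1, ideator 2

First lemmas of the two idea cards `tangent-rank-all-ones` and `transposition-trdeg`.
Statements only (sorried); they must elaborate over Mathlib + the route file.
-/

open MvPolynomial

namespace Summit.ValiantsHypothesis.ValiantsHypothesis.Cruxes.WordPerCubic.Sketch

noncomputable section

/-- variables `x_(i,j)` of the generic `n × n` matrix (Mathlib: `mvPolynomialX i j = X (i,j)`,
`permanent M = ∑ σ, ∏ i, M (σ i) i`). -/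
abbrev Var (n : ℕ) := Fin n × Fin n

/-- a letter `(i, j, c, none) ↦ E_ij(c)`, `(i, j, c, some x) ↦ E_ij(c·x)`, exactly as in the route file. -/
abbrev Letter (n : ℕ) := Fin 3 × Fin 3 × ℂ × Option (Var n)

/-- the matrix of a letter, verbatim the route's inlined word predicate. -/
def letterMat {n : ℕ} (l : Letter n) : Matrix (Fin 3) (Fin 3) (MvPolynomial (Var n) ℂ) :=
  Matrix.transvection l.1 l.2.1 (MvPolynomial.C l.2.2.1 * l.2.2.2.elim 1 MvPolynomial.X)

/-- `ℓ_B(w)`: number of letters of `w` reading a variable of the block `B`. -/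
def blockLetters {n : ℕ} (B : Finset (Var n)) (w : List (Letter n)) : ℕ :=
  (w.filter fun l => decide (∃ x ∈ B, l.2.2.2 = some x)).length

/-- partial coefficient of `f` at the `B`-exponent `μ`:
`f = ∑_μ X^μ · pcoeff B μ f` with `pcoeff B μ f ∈ ℂ[X ∖ B]` (Kalorkoti's coefficients). -/
def pcoeff {n : ℕ} (B : Finset (Var n)) (μ : Var n →₀ ℕ) (f : MvPolynomial (Var n) ℂ) :
    MvPolynomial (Var n) ℂ :=
  ∑ m ∈ f.support, if m.filter (· ∈ B) = μ then monomial (m.filter (· ∉ B)) (coeff m f) else 0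

/-- the generalized diagonal `B_d = {(i + d, i) : i}` (a permutation pattern; the `n` of them
partition the `n²` variables). -/
def diag (n : ℕ) (d : Fin n) : Finset (Var n) := Finset.univ.image fun i : Fin n => (i + d, i)

/-- the `B_d`-exponent "every diagonal-`d` position except those in columns `a` and `b`". -/
def muPair (n : ℕ) (d a b : Fin n) : Var n →₀ ℕ :=
  ∑ i ∈ (Finset.univ \ {a, b}), Finsupp.single (i + d, i) 1

/-! ## Card `tangent-rank-all-ones` — first lemma (word side, first-order Kalorkoti)
The gradients at ANY point `p` of the `B`-partial coefficients of the (0,2) entry of a word lie in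
the span of the gradients of the `9(ℓ_B+1)` entries of its maximal `B`-free segments. -/
theorem card_le_of_linearIndependent_tangent {n : ℕ} (B : Finset (Var n)) (w : List (Letter n))
    (f : MvPolynomial (Var n) ℂ) (hw : ∀ l ∈ w, l.1 ≠ l.2.1)
    (hprod : (w.map letterMat).prod = Matrix.transvection (0 : Fin 3) 2 f)
    (p : Var n → ℂ) {ι : Type} [Fintype ι] (μ : ι → (Var n →₀ ℕ))
    (hind : LinearIndependent ℂ fun i => fun y : Var n => eval p (pderiv y (pcoeff B (μ i) f))) :
    Fintype.card ι ≤ 9 * (blockLetters B w + 1) := by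
  sorry

/-! per side of `tangent-rank-all-ones`: the `|S| = n-2` coefficients are transposition monomials,
whose gradients at the all-ones matrix are `e_(b+d,a) + e_(a+d,b)` — pairwise disjoint supports. -/
theorem pcoeff_perPoly_pair (n : ℕ) (d a b : Fin n) (hab : a ≠ b) :
    pcoeff (diag n d) (muPair n d a b) (Literature.Computability.AlgebraicComplexity.perPoly (Fin n) ℂ)
      = X (b + d, a) * X (a + d, b) := by
  sorry

theorem linearIndependent_pair_tangents (n : ℕ) (d : Fin n) :
    LinearIndependent ℂ fun q : {q : Fin n × Fin n // q.1 < q.2} => fun y : Var n =>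
      eval (fun _ => (1 : ℂ)) (pderiv y
        (X (q.1.2 + d, q.1.1) * X (q.1.1 + d, q.1.2) : MvPolynomial (Var n) ℂ)) := by
  sorry

/-! ## Card `transposition-trdeg` — first lemma (word side, Kalorkoti's transcendence degree)
Any algebraically independent family of `B`-partial coefficients of the (0,2) entry has at most
`9(ℓ_B+1)` members: they live in `Algebra.adjoin ℂ {entries of the B-free segments}` whose
`Algebra.trdeg` is at most the number of generators. -/
theorem card_le_of_algebraicIndependent_pcoeff {n : ℕ} (B : Finset (Var n)) (w : List (Letter n))
    (f : MvPolynomial (Var n) ℂ) (hw : ∀ l ∈ w, l.1 ≠ l.2.1)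
    (hprod : (w.map letterMat).prod = Matrix.transvection (0 : Fin 3) 2 f)
    {ι : Type} [Fintype ι] (μ : ι → (Var n →₀ ℕ))
    (hind : AlgebraicIndependent ℂ fun i => pcoeff B (μ i) f) :
    Fintype.card ι ≤ 9 * (blockLetters B w + 1) := by
  sorry

/-! per side of `transposition-trdeg`: monomials in pairwise disjoint variable pairs are
algebraically independent. -/
theorem algebraicIndependent_pairMonomials (n : ℕ) (d : Fin n) :
    AlgebraicIndependent ℂ fun q : {q : Fin n × Fin n // q.1 < q.2} =>
      (X (q.1.2 + d, q.1.1) * X (q.1.1 + d, q.1.2) : MvPolynomial (Var n) ℂ) := by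
  sorry

/-! ## Common bookkeeping (both cards): letters split over the `n` generalized diagonals, and the
arithmetic `n · (C(n,2)/9 - 1) ≥ n³/20` for `n ≥ 20`. -/
theorem sum_blockLetters_diag_le_length {n : ℕ} (w : List (Letter n)) :
    ∑ d : Fin n, blockLetters (diag n d) w ≤ w.length := by
  sorry

example : ∀ n : ℕ, 20 ≤ n → (1 / 20 : ℝ) * (n : ℝ) ^ 3 ≤ n * ((n * (n - 1) / 2 : ℝ) / 9 - 1) := by
  intro n hn
  have h : (20 : ℝ) ≤ n := by exact_mod_cast hn
  nlinarith [h, sq_nonneg ((n : ℝ) - 20)]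

end

end Summit.ValiantsHypothesis.ValiantsHypothesis.Cruxes.WordPerCubic.Sketch
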